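import Summits.HodgeConjecture.HodgeConjecture.Theorems.F0P2aArchOrthPrelim
import Literature.MathematicalPhysics.QuantumLattice.GaugeGroupsProofs
import Literature.Geometry.ComplexHyperbolic.UnitBallSection
import Literature.Geometry.ComplexHyperbolic.UnitBallIsotropyBlock
import Literature.Geometry.ComplexHyperbolic.UnitBallQuotientManifold
import Literature.Geometry.ComplexHyperbolic.UnitBallBounds
import Mathlib.Analysis.SpecialFunctions.Complex.Circle
import Mathlib.Topology.Algebra.OpenSubgroup
import HarnessLib

/-!
# F0-P2a · S2⁺ cut L2E-i (lead p01): `U(2,1)` is connected and is generated by the exponentials of `𝔲(2,1)`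

Cell hodgecm-mathlib, FLOOR 0; crux `H413` = `stmt-HodgeConjecture-24833`; line `Cruxes/H413/Lines/F0_P2aCohIsotypicLine.lean`, stub
S2⁺ `stub_archOrth_hol`, sub-lemma L2E-i of the CUT (`F0/P2a/F0P2a-p01/CUT-S2plus.v1.md`; the hypothesis `hE` of ★
`F0P2aArchOrthHol.core` / `archOrthHol_of_cuts`).  THEOREMS ONLY; `--supports stmt-HodgeConjecture-24833 --as helper`.

* §1 `connectedSpace_unitary_complex` (`U(1)` is the continuous image of Mathlib's path-connected `Circle`),
  `connectedSpace_unitaryGroup_fin_two` (`U(2) = U(1) · SU(2)`, ★ `connectedSpace_specialUnitaryGroup`), hence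
  `U(2) × U(1)` (the tree's `K21`) is connected;
* §2 `coe_inv_eq_J_mul_conjTranspose_mul_J`, `continuous_of_continuous_mat` (continuity INTO `U(2,1) ≤ GL₃(ℂ)` from continuity of the
  matrix), `continuous_blockU`, `connectedSpace_U21`: `U(2,1) = sec(𝔹²) · (U(2) × U(1))` (★ `UnitBallSection.sec`, ★
  `instPathConnectedSpaceBall`, ★ `blockK_toK21`) is CONNECTED;
* §3 `subgroup_eq_top_of_forall_expMem_mem` — **L2E-i**: a subgroup of `U(2,1)` containing `exp X` for every `X ∈ 𝔲(2,1)` is a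
  neighbourhood of `1` (von Neumann–Cartan ★ `RealMatrixGroup.map_expMem_nhds_zero` + ★ `u21Group_regular`), hence open, hence closed,
  hence everything.

HC_CM is proved only modulo the printed citations until rung 0 closes; this file discharges none of them.

## References
* [Knapp2002] A. W. Knapp, *Lie Groups Beyond an Introduction*, I.§10 (Cor. 1.103: a connected linear group is generated by `exp 𝔤`),
  I.§17 (`U(p,q)`), VI.§2.  [Hall2015] B. C. Hall, *Lie Groups…*, Cor. 3.44–3.47.
* [BrockerTomDieck1985] T. Bröcker, T. tom Dieck, *Representations of Compact Lie Groups*, I (1.8), IV (3.1) (`U(n)`, `SU(n)` connected).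
* [Jacobowitz1990] H. Jacobowitz, *An introduction to CR structures*, Ch. 2 §1 (`U(2,1)` acting on the ball; stabiliser `U(2) × U(1)`).
-/

set_option autoImplicit false
set_option linter.dupNamespace false

noncomputable section

open scoped Matrix MatrixGroups Topology ComplexConjugate
open Filter MulAction
open Literature.NumberTheory.Automorphic
open Literature.Geometry.ComplexHyperbolic Literature.Geometry.ComplexHyperbolic.BallModel
open Literature.AlgebraicGeometry.ShimuraVarieties Literature.AlgebraicGeometry.ShimuraVarieties.BallForms
open Literature.NumberTheory.Automorphic.U21 (K21 matA sclD)
open Summit.HodgeConjecture.HodgeConjecture.Cruxes.H413.F0P2aArchOrthPrelim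

namespace Summit.HodgeConjecture.HodgeConjecture.Cruxes.H413.F0P2aL2eExpGeneration

/-! ## §1 `U(1)`, `U(2)` and `U(2) × U(1)` are connected -/

/-- `U(1) = unitary ℂ` is connected (continuous image of the path-connected `Circle`). [cite: BrockerTomDieck1985, I (1.8)] -/
theorem connectedSpace_unitary_complex : ConnectedSpace (unitary ℂ) := by
  let f : Circle → unitary ℂ := fun z => ⟨(z : ℂ), by
    rw [Unitary.mem_iff, Complex.star_def, Complex.conj_mul', Complex.mul_conj', Circle.norm_coe]
    simp⟩
  have hf : Continuous f := continuous_subtype_val.subtype_mk _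
  have hsurj : Function.Surjective f := fun U =>
    ⟨Literature.MathematicalPhysics.QuantumLattice.circleOfNormEqOne (U : ℂ) (CStarRing.norm_coe_unitary U), Subtype.ext rfl⟩
  exact hsurj.connectedSpace hf

/-- `U(2)` is connected: `U(2) = U(1) · SU(2)` through `A = diag(det A, 1) · (diag(det A, 1)⁻¹ A)`, with `SU(2)` connected
(★ `connectedSpace_specialUnitaryGroup`). [cite: BrockerTomDieck1985, I (1.8), IV (3.1)] -/
theorem connectedSpace_unitaryGroup_fin_two : ConnectedSpace (Matrix.unitaryGroup (Fin 2) ℂ) := by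
  haveI : ConnectedSpace (Matrix.specialUnitaryGroup (Fin 2) ℂ) :=
    Literature.MathematicalPhysics.QuantumLattice.connectedSpace_specialUnitaryGroup
  haveI : ConnectedSpace (unitary ℂ) := connectedSpace_unitary_complex
  have hdiag : ∀ d : unitary ℂ, Matrix.diagonal ![(d : ℂ), 1] ∈ Matrix.unitaryGroup (Fin 2) ℂ := fun d => by
    rw [Literature.MathematicalPhysics.QuantumLattice.diagonal_mem_unitaryGroup_iff]
    intro i
    fin_cases i
    · exact CStarRing.norm_coe_unitary d
    · simp
  let f : unitary ℂ × Matrix.specialUnitaryGroup (Fin 2) ℂ → Matrix.unitaryGroup (Fin 2) ℂ := fun p =>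
    ⟨Matrix.diagonal ![(p.1 : ℂ), 1] * (p.2 : Matrix (Fin 2) (Fin 2) ℂ),
      Submonoid.mul_mem _ (hdiag p.1) (Matrix.mem_specialUnitaryGroup_iff.1 p.2.2).1⟩
  have hf : Continuous f := by
    refine Continuous.subtype_mk ?_ _
    refine Continuous.mul ?_ (continuous_subtype_val.comp continuous_snd)
    refine Continuous.matrix_diagonal (continuous_pi fun i => ?_)
    fin_cases i
    · exact continuous_subtype_val.comp continuous_fst
    · exact continuous_const
  have hsurj : Function.Surjective f := by
    intro A
    let d : unitary ℂ := ⟨(A : Matrix (Fin 2) (Fin 2) ℂ).det, Matrix.det_of_mem_unitary A.2⟩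
    have hd1 : star (d : ℂ) * d = 1 := (Unitary.mem_iff.1 d.2).1
    have hd2 : (d : ℂ) * star (d : ℂ) = 1 := (Unitary.mem_iff.1 d.2).2
    let S : Matrix (Fin 2) (Fin 2) ℂ := Matrix.diagonal ![star (d : ℂ), 1] * (A : Matrix (Fin 2) (Fin 2) ℂ)
    have hSU : S ∈ Matrix.unitaryGroup (Fin 2) ℂ :=
      Submonoid.mul_mem _ (hdiag (star d)) A.2
    have hSdet : S.det = 1 := by
      rw [Matrix.det_mul, Matrix.det_diagonal, Fin.prod_univ_two]
      simp only [Matrix.cons_val_zero, Matrix.cons_val_one, mul_one]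
      exact hd1
    have hS : S ∈ Matrix.specialUnitaryGroup (Fin 2) ℂ := Matrix.mem_specialUnitaryGroup_iff.2 ⟨hSU, hSdet⟩
    refine ⟨(d, ⟨S, hS⟩), Subtype.ext ?_⟩
    show Matrix.diagonal ![(d : ℂ), 1] * (Matrix.diagonal ![star (d : ℂ), 1] * (A : Matrix (Fin 2) (Fin 2) ℂ)) = A
    rw [← Matrix.mul_assoc, Matrix.diagonal_mul_diagonal]
    have h1 : (Matrix.diagonal fun i => ![(d : ℂ), 1] i * ![star (d : ℂ), 1] i) = 1 := by
      rw [← Matrix.diagonal_one]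
      congr 1
      funext i
      fin_cases i
      · simpa using hd2
      · simp
    rw [h1, Matrix.one_mul]
  exact hsurj.connectedSpace hf

/-- `U(2) × U(1)` (the tree's `K21`) is connected. [cite: BrockerTomDieck1985, I (1.8)] -/
theorem connectedSpace_K21 : ConnectedSpace K21 := by
  haveI := connectedSpace_unitaryGroup_fin_two
  haveI := connectedSpace_unitary_complex
  infer_instance

/-! ## §2 `U(2,1)` is connected -/

/-- The inverse of `g ∈ U(2,1)` as a matrix: `g⁻¹ = J gᴴ J` (from `gᴴ J g = J`, `J² = 1`). [cite: Jacobowitz1990, Ch. 2 §1] -/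
theorem coe_inv_eq_J_mul_conjTranspose_mul_J (g : U21) :
    (((g : GL3)⁻¹ : GL3) : Matrix (Fin 3) (Fin 3) ℂ) = J * (mat g)ᴴ * J := by
  have h1 : J * (mat g)ᴴ * J * mat g = 1 := by
    calc J * (mat g)ᴴ * J * mat g = J * ((mat g)ᴴ * J * mat g) := by simp only [Matrix.mul_assoc]
      _ = 1 := by rw [mat_mem, J_mul_J]
  rw [Matrix.coe_units_inv]
  exact Matrix.inv_eq_left_inv h1

/-- Continuity INTO `U(2,1)` (with its topology of a subgroup of `GL₃(ℂ) = M₃(ℂ)ˣ`) follows from continuity of the matrix.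
[cite: Jacobowitz1990, Ch. 2 §1] -/
theorem continuous_of_continuous_mat {X : Type*} [TopologicalSpace X] (f : X → U21) (hf : Continuous fun x => mat (f x)) :
    Continuous f := by
  have hinv : Continuous fun x => (((f x : GL3)⁻¹ : GL3) : Matrix (Fin 3) (Fin 3) ℂ) := by
    simp_rw [coe_inv_eq_J_mul_conjTranspose_mul_J]
    exact (continuous_const.mul hf.matrix_conjTranspose).mul continuous_const
  have hGL : Continuous fun x => (f x : GL3) := Units.continuous_iff.2 ⟨hf, hinv⟩
  exact continuous_induced_rng.2 hGL

/-- The block embedding `blockU : U(2) × U(1) →* U(2,1)` is continuous. [cite: Jacobowitz1990, Ch. 2 §1 Lemma 6(2)] -/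
theorem continuous_blockU : Continuous (blockU : K21 → U21) := by
  refine continuous_of_continuous_mat _ ?_
  have hA : ∀ i j : Fin 2, Continuous fun k : K21 => matA k i j := fun i j =>
    ((continuous_apply j).comp ((continuous_apply i).comp (continuous_subtype_val.comp continuous_fst)))
  have hd : Continuous fun k : K21 => sclD k := continuous_subtype_val.comp continuous_snd
  refine continuous_matrix fun i j => ?_
  simp only [mat_blockU]
  fin_cases i <;> fin_cases j <;>
    simp only [bmat, Matrix.of_apply, Matrix.cons_val', Matrix.cons_val_zero, Matrix.cons_val_one, Matrix.empty_val',
      Matrix.cons_val_fin_one, Matrix.cons_val_two, Matrix.tail_cons, Matrix.head_cons, Fin.isValue, Fin.mk_one,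
      Fin.reduceFinMk] <;>
    first
    | exact continuous_const
    | exact hd
    | exact hA _ _

/-- **`U(2,1)` is connected**: it is the continuous image of `𝔹² × (U(2) × U(1))` under `(z, k) ↦ sec(z) · diag(k)` (★ the continuous
section `sec` of the orbit map with `sec z • x₀ = z`, ★ every element of `Stab(x₀)` is block diagonal), and the ball is path-connected.
[cite: Knapp2002, I.§17] [cite: Jacobowitz1990, Ch. 2 §1] -/
theorem connectedSpace_U21 : ConnectedSpace ↥U21 := by
  haveI := connectedSpace_K21
  let m : Ball × K21 → U21 := fun p => sec p.1 * blockU p.2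
  have hm : Continuous m := (continuous_sec.comp continuous_fst).mul (continuous_blockU.comp continuous_snd)
  have hsurj : Function.Surjective m := by
    intro g
    have hst : (sec (g • x₀))⁻¹ * g ∈ stabilizer (↥U21) x₀ := by
      rw [mem_stabilizer_iff, mul_smul, inv_smul_eq_iff, sec_smul_x₀]
    refine ⟨(g • x₀, toK21 ⟨_, hst⟩), ?_⟩
    show sec (g • x₀) * blockU (toK21 ⟨_, hst⟩) = g
    have hb : blockU (toK21 ⟨_, hst⟩) = (sec (g • x₀))⁻¹ * g := congrArg Subtype.val (blockK_toK21 ⟨_, hst⟩)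
    rw [hb, mul_inv_cancel_left]
  exact hsurj.connectedSpace hm

/-! ## §3 L2E-i: `U(2,1)` is generated by `exp 𝔲(2,1)` -/

/-- **L2E-i — exp-generation of `U(2,1)`.**  A subgroup of `U(2,1)` containing `exp X` for every `X ∈ 𝔲(2,1)` is all of `U(2,1)`: by
von Neumann–Cartan (★ `RealMatrixGroup.map_expMem_nhds_zero`, full Lie algebra ★ `u21Group_regular`) it is a neighbourhood of `1`, hence an
open subgroup, hence closed, hence — `U(2,1)` being connected — everything. [cite: Knapp2002, I.§10 Cor. 1.103] [cite: Hall2015, Cor. 3.47] -/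
theorem subgroup_eq_top_of_forall_expMem_mem (S : Subgroup ↥U21)
    (hS : ∀ X : u21Group.lie, (u21Group.expMem X : ↥U21) ∈ S) : S = ⊤ := by
  haveI := connectedSpace_U21
  -- `S` is a neighbourhood of `1`
  have hnhds : (S : Set ↥U21) ∈ 𝓝 (1 : ↥U21) := by
    have hmem : (S : Set ↥U21) ∈ 𝓝 (1 : ↥u21Group.carrier) := by
      rw [← u21Group.map_expMem_nhds_zero u21Group_regular]
      exact Filter.mem_map.2 (Filter.univ_mem' fun X => hS ⟨_, X.2⟩)
    exact hmem
  have hopen : IsOpen (S : Set ↥U21) := S.isOpen_of_mem_nhds hnhds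
  have hclosed : IsClosed (S : Set ↥U21) := S.isClosed_of_isOpen hopen
  have huniv : (S : Set ↥U21) = Set.univ := IsClopen.eq_univ ⟨hclosed, hopen⟩ ⟨1, S.one_mem⟩
  exact SetLike.coe_injective (huniv.trans Subgroup.coe_top.symm)

end Summit.HodgeConjecture.HodgeConjecture.Cruxes.H413.F0P2aL2eExpGeneration

end
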